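import Summits.CriticalPhenomena.PercolationContinuityZ3.Theorems.PercNearOneGluingNoHeavyQuantShapeForestLong
import Summits.CriticalPhenomena.PercolationContinuityZ3.Theorems.PercNearOneGluingNoHeavyQuantGoodSiblingsCore
import HarnessLib

/-!
# QUANT lane R8, T-DEC: THE SIBLING STEP HOLDS OUTRIGHT FOR EVERY FOREST WHOSE HARD CORE IS ≤ 3 HEAVY GLUED SIBLINGS `R^lo(R^K)` OF ONE LONG-TAIL
# SHAPE `lo < K ≤ 4lo` — any number of light glued siblings of the shape and of TAME or HULL+HIGH siblings (any sub-trees) around them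
# (census-1 gen 34; the node-shaped corollary of `sdec_shapeForests_three_long`, as g32's `sdec_forest_twoLoCore` was of `sdec_shapeForests_all_twoLo`)

builds on p205010 (kernel theorem, internal audit signed; external expert review pending)

Support file (`--supports stmt-CriticalPhenomena-4575`), QUANT lane seat prim-quant-census-1 (gen 34); memo
`run/shared/lean/prim/quant/prim-quant-census-1/g34/FOREST3-G34.md`.  Theorems only (no definitions), standard axioms, no sorries.  Uses this seat's
`sdec_shapeForest_long_append` / `shapeSib_facts` (`…QuantShapeForestLong`), g32's `sdec_append_good` (`…QuantGoodSiblingsCore`: arm-1 g57's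
`sdec_cons_of_tame` / `sdec_cons_of_hullHigh` iterated) and `sdec_flaw_perm` (`…QuantResidueForestsAll`).

WHAT IS NEW.  `sdec_shapeForests_three_long` bounds the NUMBER of siblings by 3; only the HEAVY ones (`q(lo+Kg) ≥ 2lo`, the far-giant pieces of the
expansion) need to be counted — light glued siblings are tame and ride along (`sdec_append_tame`), and so does every GOOD sibling of any other kind
(law-OK, affordable, tame or hull+high: census-1 g28/g29, arm-1 g56/g57).  So:
* **`sdec_shapeForests_long_of_fewHeavy`** — `lo < K ≤ 4lo`; every list `L` of glued siblings `⟨q,·,·,lo+K,{lo: 1−g, lo+K: g}⟩`, `0 < q, g < 1`,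
  `x ≤ qg`, of which AT MOST THREE are heavy (`(L.filter (2lo ≤ q·mean)).length ≤ 3`); `0 < x` ⟹ `SDEC x (ftop L) (flaw L)`.
* **`sdec_forest_threeLongCore`** — THE NODE-SHAPED FORM: `0 < x < 1`; `Lg` any list of GOOD siblings at `x`; `Lc` glued siblings of one shape
  `lo < K ≤ 4lo` (any parameters, `x ≤ qg`) with at most three heavy ones; every `L ~ Lg ++ Lc` ⟹ `SDEC x (ftop L) (flaw L)`.

HONEST STATUS.  Cores with `≥ 4` heavy long-tail glued siblings (`K > 2lo`), mixed shapes, 4-chains, … stay open (arm-1's `GluedDominatedMass` ⟸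
`GluedLemmaW` is the general route); `SiblingStep`, `SDECConvClosed`, `FarTreeRow` OPEN; RATE class (log\*) / honest sentence of
`run/shared/lean/prim/quant/README.md` unchanged.  [this work].  Nothing here is cited as a published result.  The gluing rows served
[cite: KozmaNitzan2024, Conjecture 3 (p. 15)]; product measure [cite: Grimmett1999, §1.3 p. 10].
-/

noncomputable section

open scoped BigOperators

namespace Summit.CriticalPhenomena.PercolationContinuityZ3.Theorems
namespace Quant
namespace LawDec

open Finset

/-- the sub-forest law of the glued sibling of shape `(lo, K)`: `S(g) = {lo: 1−g, lo+K: g}` -/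
local notation3 "SP[" lo ", " K ", " a "]" => (fun h : ℕ => (1 - (a : ℝ)) * (if h = (lo : ℕ) then (1 : ℝ) else 0) +
  (a : ℝ) * (if h = (lo : ℕ) + (K : ℕ) then (1 : ℝ) else 0))

/-! ### At most three heavy glued siblings, any number of light ones -/

/-- **EVERY FOREST OF GLUED SIBLINGS `R^lo(R^K)` OF ONE SHAPE `lo < K ≤ 4lo` WITH AT MOST THREE HEAVY MEMBERS IS SDEC AT EVERY TREE-OK FLOOR — ANY
PARAMETERS, NO ORACLE.**  `L`: siblings `⟨q,·,·,lo+K,{lo: 1−g, lo+K: g}⟩` with `0 < q, g < 1`, floor `0 < x ≤ min qᵢgᵢ`, and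
`(L.filter (2lo ≤ q·mean)).length ≤ 3` ⟹ `SDEC x (ftop L) (flaw L)` (heavy part by `sdec_shapeForest_long`, light part tame). [this work] -/
theorem sdec_shapeForests_long_of_fewHeavy (lo K : ℕ) (hloK : lo < K) (hK4 : K ≤ 4 * lo) {x : ℝ} (hx0 : 0 < x) (L : List Sib)
    (hL : ∀ s ∈ L, s.M = lo + K ∧ 0 < s.q ∧ s.q < 1 ∧ ∃ g : ℝ, 0 < g ∧ g < 1 ∧ s.ρ = SP[lo, K, g] ∧ x ≤ s.q * g)
    (hfew : (L.filter (fun s => decide (2 * (lo : ℝ) ≤ s.q * s.mean))).length ≤ 3) :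
    SDEC x (ftop L) (flaw L) := by
  have hsplit : ∀ s ∈ L, ∃ g : ℝ, s.M = lo + K ∧ 0 < s.q ∧ s.q < 1 ∧ 0 < g ∧ g < 1 ∧ s.ρ = SP[lo, K, g] ∧ x ≤ s.q * g ∧
      s.mean = (lo : ℝ) + K * g := by
    intro s hs
    obtain ⟨hM, hq0, hq1, g, hg0, hg1, hρ, hx⟩ := hL s hs
    obtain ⟨_, _, _, cm⟩ := sp_laws lo K hg0.le hg1.le
    exact ⟨g, hM, hq0, hq1, hg0, hg1, hρ, hx, by unfold Sib.mean; rw [hM, hρ]; exact cm⟩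
  have hperm : (L.filter (fun s => !decide (2 * (lo : ℝ) ≤ s.q * s.mean)) ++
      L.filter (fun s => decide (2 * (lo : ℝ) ≤ s.q * s.mean))).Perm L :=
    (List.perm_append_comm).trans (List.filter_append_perm _ L)
  refine sdec_flaw_perm hperm ?_
  refine sdec_shapeForest_long_append lo K hloK hK4 hx0 _ _ hfew ?_ ?_
  · intro s hs
    have hbs : 2 * (lo : ℝ) ≤ s.q * s.mean := by simpa using (List.mem_filter.1 hs).2
    obtain ⟨g, hM, hq0, hq1, hg0, hg1, hρ, hx, hmean⟩ := hsplit s (List.mem_of_mem_filter hs)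
    exact ⟨hM, hq0, hq1, g, hg0, hg1, hρ, by rw [← hmean]; exact hbs, hx⟩
  · intro s hs
    have hbs : s.q * s.mean < 2 * lo := by simpa using (List.mem_filter.1 hs).2
    obtain ⟨g, hM, hq0, hq1, hg0, hg1, hρ, hx, hmean⟩ := hsplit s (List.mem_of_mem_filter hs)
    exact ⟨hM, hq0, hq1, g, hg0, hg1, hρ, by rw [← hmean]; exact hbs, hx⟩

/-! ### Core = at most three heavy glued siblings of one long-tail shape -/

/-- **THE SIBLING STEP FOR EVERY FOREST WHOSE HARD CORE IS A ONE-SHAPE FAMILY OF GLUED SIBLINGS `R^lo(R^K)`, `lo < K ≤ 4lo`, WITH AT MOST THREE HEAVY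
MEMBERS — NO ORACLE.**  For `0 < x < 1`, any list `Lg` of siblings GOOD at `x` (law-OK, `x·M ≤ q·mean`, tame or hull+high — any sub-trees), any list `Lc`
of glued siblings `⟨q,·,·,lo+K,{lo: 1−g, lo+K: g}⟩` with `0 < q, g < 1`, `x ≤ qg` and `(Lc.filter (2lo ≤ q·mean)).length ≤ 3`, and every forest
`L ~ Lg ++ Lc`: `SDEC x (ftop L) (flaw L)`. [this work] -/
theorem sdec_forest_threeLongCore (lo K : ℕ) (hloK : lo < K) (hK4 : K ≤ 4 * lo) {x : ℝ} (hx0 : 0 < x) (hx1 : x < 1) (Lg Lc L : List Sib)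
    (hLg : ∀ s ∈ Lg, s.LawOK ∧ x * (s.M : ℝ) ≤ s.q * s.mean ∧
      ((∀ h : ℕ, 1 ≤ h → s.ρ h ≠ 0 → s.q * s.mean ≤ 2 * h ∨ x * ((s.M : ℝ) - h) ≤ s.q * s.mean - h) ∨
        HullHigh x (s.q * s.mean) s.M (gate s.ρ s.q)))
    (hLc : ∀ s ∈ Lc, s.M = lo + K ∧ 0 < s.q ∧ s.q < 1 ∧ ∃ g : ℝ, 0 < g ∧ g < 1 ∧ s.ρ = SP[lo, K, g] ∧ x ≤ s.q * g)
    (hfew : (Lc.filter (fun s => decide (2 * (lo : ℝ) ≤ s.q * s.mean))).length ≤ 3) (hperm : (Lg ++ Lc).Perm L) :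
    SDEC x (ftop L) (flaw L) := by
  have hlo : 1 ≤ lo := by omega
  have fc : ∀ s ∈ Lc, s.LawOK ∧ x * (s.M : ℝ) ≤ s.q * s.mean := fun s hs =>
    ⟨(shapeSib_facts lo K hlo s (hLc s hs)).1, (shapeSib_facts lo K hlo s (hLc s hs)).2.1⟩
  refine sdec_flaw_perm hperm ?_
  exact sdec_append_good hx0 hx1 Lc (fun t ht => (fc t ht).1) (fun t ht => (fc t ht).2)
    (sdec_shapeForests_long_of_fewHeavy lo K hloK hK4 hx0 Lc hLc hfew) Lg (fun s hs => (hLg s hs).1) (fun s hs => (hLg s hs).2.1)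
    (fun s hs => (hLg s hs).2.2)

end LawDec
end Quant
end Summit.CriticalPhenomena.PercolationContinuityZ3.Theorems
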